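import Summits.BirchSwinnertonDyer.BirchSwinnertonDyer.Theorems.EisensteinPrimesAnalyticLambdaAbsoluteCount
import HarnessLib

/-!
# Route `EisensteinPrimes`, line `mudescent`, crux 3: Mazur's main conjecture at the ÉTALE END of a
# Pollack–Wake-family pair from THEOREM B's congruence and lam-b's layer-0 Tamagawa budget
# (route T composed end to end; helper; THEOREMS ONLY)

Seat `bsd-eis-lam-a` g9 (PROGRAMME PART 1b, ACCEL-LIST (4); items stmt-BirchSwinnertonDyer-19033 / -19035;
skeleton owner bsd-eis-ky). No definition, no named fact beyond the PUBLISHED hypotheses named below;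
nothing about any particular curve; closes nothing; moves no label.

WHAT. `EisensteinPrimesAnalyticLambdaAbsoluteCount` §5 turns THEOREM B's value congruence
(`G_E ≡ c·U·∏_{ℓ∈S}(1 − γ_ℓ)`, `U ∈ Λˣ` Pollack–Wake's cuspidal unit) plus ANY algebraic budget
`AlgebraicLambdaGE W p k`, `k ≥ Σ s_ℓ (−1 at a split p)`, into `X2.MazurMainConjectureAt W p`. This file
DISCHARGES the budget at the étale end of a split pair with lam-b's layer-0 count
`X2.algebraicLambdaGE_of_dvd_torsionOrder_of_dvd_localTamagawaNumber` (Poitou–Tate over `ℚ`, Greenberg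
Prop. 4.15 (ii), Wuthrich Thm. 16, modularity; per-pair data: `p ∣ #E(ℚ)_tors` with `v_p = 1`, Tamagawa
witnesses `S'` at places `v ∤ p` with `p ∣ c_v`), under the side condition `Σ_{ℓ∈S} s_ℓ ≤ #S'` — on
the family every split `ℓ ∉ {p, q}` is such a witness (MEMO-9 §3 (i)), so the condition reads «all
`s_ℓ = 1`» (e.g. 110a1, 710d1, 4910g1, 1870h1, 6970h1 at `p = 5`; it fails for 1155n1 where `s_7 = 5`,
which needs the tower budget). HONEST FRAMING: the congruence `hval` is THEOREM B ON PAPER (HOME/lam-a-g9/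
lam-a-MEMO-9.md §3), not a tree fact; everything else is a named PUBLISHED fact or a tree theorem.

References: [Wuthrich2014] Thm. 16; [PollackWake2025] Thm. 5.12 (1); [GreenbergLNM1716] §5 pp. 114–118,
p. 137, Prop. 4.15 (ii); [SilvermanATAEC1994] Cor. IV.9.2(d); HOME/lam-a-g9/lam-a-MEMO-9.md §5.
-/

set_option linter.dupNamespace false
set_option autoImplicit false

noncomputable section

open scoped Classical MatrixGroups ModularForm

open PowerSeries CongruenceSubgroup WeierstrassCurve NumberField IsDedekindDomain
  Literature.NumberTheory.EllipticCurves
  Literature.NumberTheory.EllipticCurves.ModularForms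
  Literature.NumberTheory.EllipticCurves.Rank1Residual
  Literature.NumberTheory.EllipticCurves.GreenbergVatsal2000
  Summit.BirchSwinnertonDyer.Rank1Residual
  Summit.BirchSwinnertonDyer.Rank1Residual.X1.MuLambda
  Summit.BirchSwinnertonDyer.Rank1Residual.X11a
  Summit.BirchSwinnertonDyer.Rank1Residual.Iwasawa
  Summit.BirchSwinnertonDyer.Rank1Residual.X2.EulerFactorAlgebra
  Summit.BirchSwinnertonDyer.Rank1Residual.X2.EulerFactorInvariants
  Summit.BirchSwinnertonDyer.Rank1Residual.X2.GreenbergVatsalAnalyticTransferCore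
  Summit.BirchSwinnertonDyer.BirchSwinnertonDyer.Theorems
  Summit.BirchSwinnertonDyer.BirchSwinnertonDyer.Theorems.EisensteinPrimesAnalyticLambdaCongruenceTransfer
  Summit.BirchSwinnertonDyer.BirchSwinnertonDyer.Theorems.EisensteinPrimesAnalyticLambdaValueCongruence
  Summit.BirchSwinnertonDyer.BirchSwinnertonDyer.Theorems.EisensteinPrimesX2AnalyticLambdaResultantCertificate
  Summit.BirchSwinnertonDyer.BirchSwinnertonDyer.Theorems.EisensteinPrimesAnalyticLambdaAbsoluteCount

namespace Summit.BirchSwinnertonDyer.BirchSwinnertonDyer.Theorems.EisensteinPrimesAnalyticLambdaAbsoluteCountRouteT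

variable {p : ℕ} [hp : Fact p.Prime]

/-! ## §1. Route T fed by THEOREM B AND lam-b's layer-0 budget at the étale end: Mazur's main
conjecture at a split pair of the family from the congruence, Tamagawa witnesses and `s_ℓ`-data -/

section RouteTEtaleEnd

variable {W : WeierstrassCurve ℚ} [W.IsElliptic] [W.IsGloballyMinimal]
  {N : ℕ} [NeZero N] {f : CuspForm (Gamma0 N) 2} {ϖ : ℚ} {L : PowerSeries ℚ_[p]}

/-- **Crux 3 at the ÉTALE END of a Pollack–Wake-family pair with `p ∣ N`, from THEOREM B's congruence
and published facts plus per-pair integer data.** `W` globally minimal, `p ≠ 2` multiplicative with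
`p ∣ #E(ℚ)_tors` and `v_p(#E(ℚ)_tors) = 1` (the étale end; then `p` is split and `E[p]` reducible —
tree `X2.TorsionForcesSplit`); `S'` a finite set of places `v ∤ p` with `p ∣ c_v(E)` (Kodaira–Néron
witnesses: on the family EVERY split `ℓ ∉ {p, q}` qualifies, MEMO-9 §3 (i)); ONE datum `(f, ϖ, L, G)` with
THEOREM B's value congruence against `c·U·∏_{ℓ∈S}(1 − γ_ℓ)` (`U ∈ Λˣ`, `S` integers `> 1` prime to `p`);
and the numerical side conditions `#S' ≥ 1`, `Σ_{ℓ∈S} s_ℓ ≤ #S'` (e.g. `S` = the primes under `S'`,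
all with `s_ℓ = 1`; `S' ≠ ∅` is THEOREM B (iv) at a split `p`). Named PUBLISHED facts: Poitou–Tate duality over `ℚ` (`hPT`), Greenberg Prop. 4.15 (ii)
(`h415`), Wuthrich 2014 Thm. 16 (`hWu`), modularity (`hpar`). Conclusion: `X2.MazurMainConjectureAt W p`.
Proof: §3 gives `μ_an = 0` and `λ_an = Σ s_ℓ`; lam-b's
`X2.algebraicLambdaGE_of_dvd_torsionOrder_of_dvd_localTamagawaNumber` (fed by that `μ_an = 0`) gives
`λ_alg ≥ #S' − 1`; route T at a split prime needs `λ_an ≤ λ_alg + 1`. (MEMO-9 §5: instances 110a1,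
710d1, 4910g1 @5 with `S' = {2}`, 1870h1/6970h1 with `S' = {2, 17}` — modulo the congruence, which is
THEOREM B on paper.) [cite: Wuthrich2014, Thm. 16 (p. 397)] [cite: PollackWake2025, Thm. 5.12 (1)]
[cite: GreenbergLNM1716, §5 pp. 114–118, p. 137, Prop. 4.15 (ii)] [cite: SilvermanATAEC1994, Cor. IV.9.2(d)] -/
theorem X2.mazurMainConjectureAt_etaleEnd_of_valueCongr_unit_of_dvd_localTamagawaNumber (hp2 : p ≠ 2)
    (hPT : Literature.NumberTheory.GaloisCohomology.poitouTate_selmerStructure_duality ℚ)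
    (h415 : Greenberg1999.prop415ii_noFiniteSubmodule_of_ordinary_or_multiplicative)
    (hWu : Wuthrich2014.thm16_charIdeal_dvd_multiplicative_of_reducible)
    (hpar : nonempty_modularParametrizationData)
    (hmult : W.HasMultiplicativeReductionAtPrime p) (htors : p ∣ W.torsionOrder)
    (hfac : (W.torsionOrder).factorization p = 1)
    (S' : Finset (HeightOneSpectrum (𝓞 ℚ))) (hSp : ∀ v ∈ S', ((p : ℕ) : 𝓞 ℚ) ∉ v.asIdeal)
    (hcv : ∀ v ∈ S',
      p ∣ (W.baseChange (v.adicCompletion ℚ)).localTamagawaNumber (v.adicCompletionIntegers ℚ))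
    (hf : IsNewformOf W f) (hϖ : (ϖ : ℝ) * W.realPeriodRat = plusPeriod f)
    (hLs : W.HasSplitMultiplicativeReductionAtPrime p → IsSplitMultPAdicLFunctionOf f p L)
    (hLn : ¬ W.HasSplitMultiplicativeReductionAtPrime p → IsMultPAdicLFunctionOf f p (-1) L)
    {G : IwasawaAlgebra p} (hG : iwasawaToPowerSeries p G = PowerSeries.C ((ϖ : ℚ) : ℚ_[p]) * L)
    {U : IwasawaAlgebra p} (hU : IsUnit U) (S : Finset ℕ) (hS : ∀ ℓ ∈ S, p.Coprime ℓ ∧ 1 < ℓ)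
    {c : ℤ_[p]} (hc : IsUnit c) {n₀ : ℕ}
    (hval : ∀ m : ℕ, n₀ ≤ m → ∀ ζ : ℂ_[p], IsPrimitiveRoot ζ (p ^ (m + 1)) →
      ‖∑' k, ((algebraMap ℚ_[p] ℂ_[p]).comp (algebraMap ℤ_[p] ℚ_[p]))
          (PowerSeries.coeff k (G - PowerSeries.C c * (U * ∏ ℓ ∈ S, (1 - frobeniusSeries p ℓ)))) *
            (ζ - 1) ^ k‖ ≤ (p : ℝ)⁻¹)
(hS'1 : 1 ≤ S'.card) (hsum : ∑ ℓ ∈ S, sFactor p ℓ ≤ S'.card) :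
    X2.MazurMainConjectureAt W p := by
  obtain ⟨hμ0, hlam⟩ := X2.analyticMuLE_zero_and_analyticLambdaEq_sum_sFactor_of_valueCongr hp2 hf hϖ
    hLs hLn hG hU S hS hc hval
  have hred : ¬ W.HasIrreducibleModPGaloisRep p := not_hasIrreducibleModPGaloisRep_of_dvd_torsionOrder W p htors
  have hp3 : 3 ≤ p := by
    have h2 := hp.out.two_le
    omega
  have hsplit : W.HasSplitMultiplicativeReductionAtPrime p :=
    X2.hasSplitMultiplicativeReductionAtPrime_of_dvd_torsionOrder W p hp3 hmult htors
  have hb : S'.card - 1 + 2 * (W.torsionOrder).factorization p ≤ S'.card + 1 := by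
    rw [hfac]; omega
  have halg : X1.TamagawaSqueeze.AlgebraicLambdaGE W p (S'.card - 1 - 0) :=
    EisensteinPrimesX2AlgebraicLambdaGESplitTorsion.X2.algebraicLambdaGE_of_dvd_torsionOrder_of_dvd_localTamagawaNumber
      hp2 hPT h415 hWu hpar hmult htors S' hSp hcv hμ0 hb
  rw [Nat.sub_zero] at halg
  have hk : ∑ ℓ ∈ S, sFactor p ℓ ≤ S'.card - 1 + 1 := by omega
  exact X2.mazurMainConjectureAt_of_algebraicLambdaGE hWu W p hp2 hmult hred hμ0 hlam halg
    (fun hns ↦ absurd hsplit hns) (fun _ ↦ hk)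

end RouteTEtaleEnd

end Summit.BirchSwinnertonDyer.BirchSwinnertonDyer.Theorems.EisensteinPrimesAnalyticLambdaAbsoluteCountRouteT

end
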